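import Mathlib
import Summits.ValiantsHypothesis.ValiantsHypothesis.Theorems.DivisionGapPerMultiplesHardStubBoardCompression
import Literature.Computability.AlgebraicComplexity.ArithCircuitProofs
import Literature.Computability.AlgebraicComplexity.PermanentIrreducible

/-!
# `DivisionGap.PerMultiplesHard` (stmt-ValiantsHypothesis-5068), line `uncharged-face-walk`:
board compression of a level slice (stub `stub_boardCompressionGen`)

A polynomial `c` over `ℝ≥0` on the `m × m` board all of whose exponents have row margins `v·𝟙_S`
and column margins `v·𝟙_T` (`#S = #T = k`, `v ≥ 1`) moves to the `k × k` board without increasing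
the tree's fan-in-two `complexity`, with ALL row and column margins `v` there, and with at least
as many PURE exponents (exponents supported inside the graph `{(σ j, j)}` of a permutation `σ`).

Mechanism (the landed `BoardCompression.stub_boardCompression` with margins `v` in place of `1`,
plus the transfer of pure exponents).
1. No exponent of `c` touches a cell off `S × T`: a cell `(p, q)` with `p ∉ S` would make the row
   sum of `p` positive (columns alike).
2. ONE PROJECTION (`IsProjection.complexity_le_holds`): enumerate `S` and `T` by `Fin k`
   (`Finset.orderIsoOfFin`), send the cell `(eS s, eT t)` to `X (s, t)` and every cell off `S × T`
   to `1`.  Then `a · x^M ↦ a · x^{M'}` with `M' (s, t) = M (eS s, eT t)`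
   (`BoardCompression.aeval_prj_monomial`), `M ↦ M'` is injective on exponents living on
   `S × T`, and the support of the image is the image of `supp c`
   (`BoardCompression.mem_support_sum_monomial_iff`); margins are read through the enumeration.
3. PURE TRANSFER (`exists_perm_of_pure_pullback`): if `M` lives inside `σ : Perm (Fin m)`, every
   column `t` of `M'` carries its margin `v ≥ 1` on a single cell `(g t, t)` with
   `eS (g t) = σ (eT t)`; `g` is injective, hence a permutation of `Fin k`, and `M'` lives inside
   it.  So `M ↦ M'` maps the pure exponents of `c` injectively into those of the image
   (`Finset.card_le_card_of_injOn`).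

Log (stub-worker): written on the `BoardCompression` API. [folklore]
-/

noncomputable section

open MvPolynomial Literature.Computability.AlgebraicComplexity
open scoped NNReal BigOperators

-- `Summit.<S>.<S>.…` repeats `ValiantsHypothesis` BY DESIGN (single-problem summit, D-0017)
set_option linter.dupNamespace false

open Summit.ValiantsHypothesis.ValiantsHypothesis.Theorems.DivisionGap.PerMultiplesHard.BoardCompression

namespace Summit.ValiantsHypothesis.ValiantsHypothesis.Theorems.DivisionGap.PerMultiplesHard.BoardCompressionGen

variable {n k : ℕ} {S T : Finset (Fin n)}

/-! ### Pure exponents stay pure on the small board -/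

/-- **Pure transfer.**  Let `M'` on the `k × k` board be read off `M` on the `n × n` board through
enumerations `eS` of `S` and `eT` of `T` (`M' (s, t) = M (eS s, eT t)`), with no zero column.  If
`M` is supported inside the graph of a permutation `σ` of `Fin n`, then `M'` is supported inside
the graph of a permutation of `Fin k`: the row `g t` of a nonzero cell of column `t` satisfies
`eS (g t) = σ (eT t)`, so `g` is injective, hence bijective, and serves. [folklore] -/
theorem exists_perm_of_pure_pullback (eS : Fin k ≃ {x // x ∈ S}) (eT : Fin k ≃ {x // x ∈ T})
    {M : (Fin n × Fin n) →₀ ℕ} {M' : (Fin k × Fin k) →₀ ℕ}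
    (hMM : ∀ s t, M' (s, t) = M ((eS s : Fin n), (eT t : Fin n)))
    (hcol : ∀ t, ∃ s, M' (s, t) ≠ 0)
    {σ : Equiv.Perm (Fin n)} (hσ : ∀ e ∈ M.support, e.1 = σ e.2) :
    ∃ σ' : Equiv.Perm (Fin k), ∀ e ∈ M'.support, e.1 = σ' e.2 := by
  choose g hg using hcol
  -- a nonzero cell `(s, t)` of `M'` sits on the graph of `σ`, read through the enumerations
  have hkey : ∀ s t, M' (s, t) ≠ 0 → (eS s : Fin n) = σ (eT t : Fin n) := fun s t hst =>
    hσ ((eS s : Fin n), (eT t : Fin n)) (Finsupp.mem_support_iff.2 (by rw [← hMM s t]; exact hst))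
  have hg_inj : Function.Injective g := by
    intro t t' htt'
    have h1 := hkey (g t) t (hg t)
    have h2 := hkey (g t') t' (hg t')
    rw [htt'] at h1
    exact eT.injective (Subtype.ext (σ.injective (h1.symm.trans h2)))
  refine ⟨Equiv.ofBijective g (Finite.injective_iff_bijective.mp hg_inj), ?_⟩
  rintro ⟨s, t⟩ hst
  rw [Equiv.ofBijective_apply]
  exact eS.injective (Subtype.ext
    ((hkey s t (Finsupp.mem_support_iff.1 hst)).trans (hkey (g t) t (hg t)).symm))

/-! ### The stub -/

/-- **Board compression of a level slice (stub `stub_boardCompressionGen` of line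
`uncharged-face-walk`).**  If every exponent of `c` (on the `m × m` board, over `ℝ≥0`) has row
margins `v·𝟙_S` and column margins `v·𝟙_T` with `#S = #T = k` and `v ≥ 1`, then some `c'` on
the `k × k` board has all row and column margins of all its exponents equal to `v`,
`L(c') ≤ L(c)`, and at least as many pure exponents as `c`: `c'` is the image of `c` under the
projection sending `S × T` (enumerated by `Fin k × Fin k`) to the variables of the small board and
every other cell to `1`; projections are free, the induced map on exponents is injective on
`supp c`, reads margins through the enumerations, and keeps pure exponents pure. [folklore] -/
theorem stub_boardCompressionGen :
    ∀ (m k v : ℕ) (S T : Finset (Fin m)) (c : MvPolynomial (Fin m × Fin m) ℝ≥0), S.card = k → T.card = k → 1 ≤ v →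
      (∀ M ∈ c.support, (∀ i, ∑ j, M (i, j) = if i ∈ S then v else 0) ∧
        (∀ j, ∑ i, M (i, j) = if j ∈ T then v else 0)) →
      ∃ c' : MvPolynomial (Fin k × Fin k) ℝ≥0,
        (∀ M ∈ c'.support, (∀ i, ∑ j, M (i, j) = v) ∧ (∀ j, ∑ i, M (i, j) = v)) ∧
        complexity c' ≤ complexity c ∧
        (c.support.filter fun M => ∃ σ : Equiv.Perm (Fin m), ∀ e ∈ M.support, e.1 = σ e.2).card ≤
          (c'.support.filter fun M => ∃ σ : Equiv.Perm (Fin k), ∀ e ∈ M.support, e.1 = σ e.2).card := by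
  -- adapted from `BoardCompression.stub_boardCompression` (same tree, line `uncharged-face-walk`)
  intro n k v S T a hS hT hv hmarg
  classical
  -- enumerations of `S` and `T`
  set eS : Fin k ≃ {x // x ∈ S} := (S.orderIsoOfFin hS).toEquiv
  set eT : Fin k ≃ {x // x ∈ T} := (T.orderIsoOfFin hT).toEquiv
  -- (1) cells off `S × T` carry no exponent
  have hoff : ∀ M ∈ a.support, ∀ e : Fin n × Fin n, ¬ (e.1 ∈ S ∧ e.2 ∈ T) → M e = 0 := by
    intro M hM e he
    obtain ⟨p, q⟩ := e
    by_cases hp : p ∈ S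
    · have hq : q ∉ T := fun hq => he ⟨hp, hq⟩
      have h0 := (hmarg M hM).2 q
      rw [if_neg hq] at h0
      exact Finset.sum_eq_zero_iff.1 h0 p (Finset.mem_univ _)
    · have h0 := (hmarg M hM).1 p
      rw [if_neg hp] at h0
      exact Finset.sum_eq_zero_iff.1 h0 q (Finset.mem_univ _)
  -- the pullback of exponents to the small board, by specification
  obtain ⟨pb, hpb⟩ : ∃ pb : ((Fin n × Fin n) →₀ ℕ) → ((Fin k × Fin k) →₀ ℕ),
      ∀ M s t, pb M (s, t) = M ((eS s : Fin n), (eT t : Fin n)) :=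
    ⟨fun M => Finsupp.equivFunOnFinite.symm fun st => M ((eS st.1 : Fin n), (eT st.2 : Fin n)),
      fun _ _ _ => rfl⟩
  -- (2) the projection, by specification
  obtain ⟨prj, hpX, hp1, hpP⟩ : ∃ prj : Fin n × Fin n → MvPolynomial (Fin k × Fin k) ℝ≥0,
      (∀ s t, prj ((eS s : Fin n), (eT t : Fin n)) = X (s, t)) ∧
      (∀ e : Fin n × Fin n, ¬ (e.1 ∈ S ∧ e.2 ∈ T) → prj e = 1) ∧
      ∀ e, (∃ u, prj e = X u) ∨ ∃ r, prj e = C r := by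
    refine ⟨fun e => if hx : e.1 ∈ S ∧ e.2 ∈ T then
      X (eS.symm ⟨e.1, hx.1⟩, eT.symm ⟨e.2, hx.2⟩) else 1, fun s t => ?_, fun e he => dif_neg he,
      fun e => ?_⟩
    · dsimp only
      rw [dif_pos ⟨(eS s).2, (eT t).2⟩]
      simp
    · dsimp only
      by_cases he : e.1 ∈ S ∧ e.2 ∈ T
      · exact Or.inl ⟨_, dif_pos he⟩
      · exact Or.inr ⟨1, by rw [dif_neg he, C_1]⟩
  -- the pullback is injective on the exponents of `a`
  have hinj : Set.InjOn pb a.support := by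
    intro M₁ hM₁ M₂ hM₂ heq
    ext ⟨p, q⟩
    by_cases h : p ∈ S ∧ q ∈ T
    · have h' := DFunLike.congr_fun heq (eS.symm ⟨p, h.1⟩, eT.symm ⟨q, h.2⟩)
      simpa [hpb] using h'
    · rw [hoff M₁ hM₁ _ h, hoff M₂ hM₂ _ h]
  -- the pulled-back exponents have all margins `v`
  have hrow : ∀ M ∈ a.support, ∀ s, ∑ t, pb M (s, t) = v := by
    intro M hM s
    have h1 := (hmarg M hM).1 (eS s)
    rw [if_pos (eS s).2] at h1
    calc ∑ t, pb M (s, t) = ∑ t : Fin k, M ((eS s : Fin n), (eT t : Fin n)) := by simp only [hpb]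
      _ = ∑ q : {x // x ∈ T}, M ((eS s : Fin n), (q : Fin n)) :=
          eT.sum_comp (fun q : {x // x ∈ T} => M ((eS s : Fin n), (q : Fin n)))
      _ = ∑ q ∈ T, M ((eS s : Fin n), q) :=
          Finset.sum_coe_sort T (fun q => M ((eS s : Fin n), q))
      _ = ∑ q, M ((eS s : Fin n), q) :=
          Finset.sum_subset (Finset.subset_univ T) fun q _ hq =>
            hoff M hM ((eS s : Fin n), q) fun h => hq h.2
      _ = v := h1
  have hcol : ∀ M ∈ a.support, ∀ t, ∑ s, pb M (s, t) = v := by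
    intro M hM t
    have h1 := (hmarg M hM).2 (eT t)
    rw [if_pos (eT t).2] at h1
    calc ∑ s, pb M (s, t) = ∑ s : Fin k, M ((eS s : Fin n), (eT t : Fin n)) := by simp only [hpb]
      _ = ∑ p : {x // x ∈ S}, M ((p : Fin n), (eT t : Fin n)) :=
          eS.sum_comp (fun p : {x // x ∈ S} => M ((p : Fin n), (eT t : Fin n)))
      _ = ∑ p ∈ S, M (p, (eT t : Fin n)) :=
          Finset.sum_coe_sort S (fun p => M (p, (eT t : Fin n)))
      _ = ∑ p, M (p, (eT t : Fin n)) :=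
          Finset.sum_subset (Finset.subset_univ S) fun p _ hp =>
            hoff M hM (p, (eT t : Fin n)) fun h => hp h.1
      _ = v := h1
  -- no column of a pulled-back exponent vanishes (`v ≥ 1`)
  have hex : ∀ M ∈ a.support, ∀ t, ∃ s, pb M (s, t) ≠ 0 := fun M hM t => by
    obtain ⟨s, -, hs⟩ := Finset.exists_ne_zero_of_sum_ne_zero
      (show ∑ s, pb M (s, t) ≠ 0 by rw [hcol M hM t]; exact Nat.one_le_iff_ne_zero.mp hv)
    exact ⟨s, hs⟩
  -- the image of `a` as a sum of monomials
  have hsum : aeval prj a = ∑ M ∈ a.support, monomial (pb M) (coeff M a) := by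
    conv_lhs => rw [a.as_sum]
    rw [map_sum]
    refine Finset.sum_congr rfl fun M _ => ?_
    rw [aeval_prj_monomial eS eT prj hpX hp1 (fun s t => (hpb M s t).symm) (coeff M a),
      C_mul_monomial, mul_one]
  have hmem : ∀ d, d ∈ (aeval prj a).support ↔ ∃ M ∈ a.support, pb M = d := fun d => by
    rw [hsum]
    exact mem_support_sum_monomial_iff hinj (fun M hM => mem_support_iff.1 hM) d
  refine ⟨aeval prj a, fun d hd => ?_, IsProjection.complexity_le_holds ⟨prj, hpP, rfl⟩, ?_⟩
  · -- all margins `v`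
    obtain ⟨M, hM, rfl⟩ := (hmem d).1 hd
    exact ⟨hrow M hM, hcol M hM⟩
  · -- (3) pure exponents map injectively to pure exponents
    refine Finset.card_le_card_of_injOn pb (fun M hM => ?_) fun M₁ hM₁ M₂ hM₂ heq => ?_
    · obtain ⟨hM, σ, hσ⟩ := Finset.mem_filter.1 (Finset.mem_coe.1 hM)
      exact Finset.mem_coe.2 (Finset.mem_filter.2 ⟨(hmem _).2 ⟨M, hM, rfl⟩,
        exists_perm_of_pure_pullback eS eT (hpb M) (hex M hM) hσ⟩)
    · exact hinj (Finset.mem_filter.1 (Finset.mem_coe.1 hM₁)).1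
        (Finset.mem_filter.1 (Finset.mem_coe.1 hM₂)).1 heq

end Summit.ValiantsHypothesis.ValiantsHypothesis.Theorems.DivisionGap.PerMultiplesHard.BoardCompressionGen

end
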